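import Summits.BirchSwinnertonDyer.BirchSwinnertonDyer.Theorems.ManinLocalTwoThreeStevensIntegralityGamma1Multiplier
import Summits.BirchSwinnertonDyer.BirchSwinnertonDyer.Theorems.ManinLocalTwoThreeCDivisionIntegralCDT

/-!
# The Manin constant and the content of `Λ₁(f)` in `Λ₀(f)` (MEMO-imc §50, the `d = 1` shadow; TURNKEY T-imc-50)

Summit `BirchSwinnertonDyer`, route `ManinLocalTwoThree` (cell bsd-f2-manin), crux C2 `ManinOddAtFour`
(stmt-BirchSwinnertonDyer-22967).  Planner seat bsd-f2-manin-imc (LENS imc), gen 38, `Sketch50.lean` §3 (sha16 b82adeeaaaa17330,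
audited ref1 §R289); landed verbatim by the prover seat p1 (gen 25).

THE `d = 1` SHADOW OVER TREE DECLARATIONS (the only printed input is CDT, as the tree's hypothesis
`CalegariDimitrovTang2025_unboundedDenominators`).  The `Γ₁`-integrality «every `q ∈ ℚ` with `q·Λ₁(f) ⊆ Λ_W` is an integer»
(Gabber; Conrad–Edixhoven–Stein 2003 Lemma 6.1.6) is ALREADY A TREE THEOREM, fact-free:
`StevensIntegrality.int_of_smul_periodLatticeGamma1_le_of_datum₀` (p2 g25) — cited, not restated.  From it:
`contentDividesManinConstant_holds` («`Λ₁(f) ⊆ m·Λ₀(f)` ⟹ `m ∣ c₀`», LEMMA 50.X for `d = 1`, FACT-FREE); with the tree's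
«`Λ₁(f) ⊆ Λ_W` mod CDT» (`CDivisionInt.periodLatticeGamma1_le_neron_of_CDTInt`): **`|c₀| = m₁(f)`**, the CONTENT of `Λ₁(f)` in `Λ₀(f)`
(`natAbs_maninConstant_eq_content_of_CDT`, THEOREM 50.T for `d = 1`) and `2 ∣ c₀ ↔ Λ₁(f) ⊆ 2Λ₀(f)`
(`two_dvd_maninConstant_iff_gamma1_le_two_smul_of_CDT`, the C2 reading).  HONEST FRAMING: conditional on the printed CDT theorem
exactly as the route's other CDT consumers; Manin's conjecture, C2/C3 and BSD are NOT proved here.  No sorry.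
[cite: ConradEdixhovenStein2003, Lemma 6.1.6] [cite: CesnaviciusNeururerSaha2023, Lemma 2.2] [cite: Stevens1989, §2]
[cite: AgasheRibetStein2006, Remark 3.6] [cite: CalegariDimitrovTang2025, Thm. 1.0.1]
-/

set_option autoImplicit false
-- the summit-side namespace `Summit.BirchSwinnertonDyer.BirchSwinnertonDyer.…` is the tree's (summit = sub-problem)
set_option linter.dupNamespace false

namespace Summit.BirchSwinnertonDyer.BirchSwinnertonDyer.Theorems.ManinLocalTwoThree.ManinConstantContent

open scoped MatrixGroups ModularForm
open CongruenceSubgroup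
open WeierstrassCurve Literature.NumberTheory.EllipticCurves Literature.NumberTheory.EllipticCurves.ModularForms
open Literature.NumberTheory.Automorphic
open Summit.BirchSwinnertonDyer.BirchSwinnertonDyer.Theorems.ManinLocalTwoThree

/-- **E-imc-50X (`d = 1` shadow of LEMMA 50.X)**: for every `X₀(N)`-datum of a globally minimal curve, if `Λ₁(f) ⊆ m·Λ₀(f)`
(`m ≠ 0`) then `m ∣ c`.  (For the lattice-optimal datum `c = c₀`, the Manin constant of the optimal curve.) -/
def ContentDividesManinConstant : Prop :=
  ∀ {N : ℕ} [NeZero N] {W : WeierstrassCurve ℚ} [W.IsElliptic] [W.IsGloballyMinimal]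
    (D : ModularParametrizationData W N) (m : ℤ), m ≠ 0 →
    (∀ z ∈ periodLatticeGamma1 D.f, ∃ w ∈ periodLattice D.f, z = (m : ℂ) * w) → m ∣ D.maninConstant

/-- LEMMA 50.X for `d = 1`, **fact-free**: `Λ₁(f) ⊆ mΛ₀(f)` ⟹ `m ∣ c` (the tree's `Γ₁`-integrality theorem applied to `q = c/m`:
`(c/m)·Λ₁ ⊆ (c/m)·mΛ₀ = cΛ₀ ⊆ Λ_W`). [cite: ConradEdixhovenStein2003, Lemma 6.1.6] [cite: Stevens1989, §1 Thm. 1.3] -/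
theorem contentDividesManinConstant_holds : ContentDividesManinConstant := by
  intro N _ W _ _ D m hm hdiv
  have hq : ∀ z ∈ periodLatticeGamma1 D.f, (((D.c : ℚ) / m : ℚ) : ℂ) * z ∈ D.L.lattice := by
    intro z hz
    obtain ⟨w, hw, rfl⟩ := hdiv z hz
    have hmC : (m : ℂ) ≠ 0 := by exact_mod_cast hm
    have : (((D.c : ℚ) / m : ℚ) : ℂ) * ((m : ℂ) * w) = (D.c : ℂ) * w := by
      push_cast
      field_simp
    rw [this]
    exact D.smul_periodLattice_le w hw
  obtain ⟨k, hk⟩ := StevensIntegrality.int_of_smul_periodLatticeGamma1_le_of_datum₀ D ((D.c : ℚ) / m) hq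
  have hmQ : (m : ℚ) ≠ 0 := by exact_mod_cast hm
  have hck : (D.c : ℚ) = k * m := by rw [hk]; field_simp
  have hcz : D.c = k * m := by exact_mod_cast hck
  show m ∣ D.maninConstant
  simp only [ModularParametrizationData.maninConstant]
  exact ⟨k, by rw [hcz, mul_comm]⟩

/-- **THEOREM 50.T for `d = 1`: `|c₀| = m₁(f)` EXACTLY, modulo CDT.**  For a lattice-optimal `X₀(N)`-datum (`Λ_W = c₀Λ₀(f)`) of a globally
minimal curve and `m > 0` the CONTENT of `Λ₁(f)` in `Λ₀(f)` — `Λ₁ ⊆ mΛ₀`, and every `m' ≠ 0` with `Λ₁ ⊆ m'Λ₀` divides `m` — one has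
`|c₀| = m`: `m ∣ c₀` is `contentDividesManinConstant_holds`; `c₀ ∣ m` because `Λ₁(f) ⊆ Λ_W = c₀Λ₀(f)` modulo CDT
(`CDivisionInt.periodLatticeGamma1_le_neron_of_CDTInt`).  So, modulo CDT, the Manin constant of the optimal curve is COMPUTABLE from modular
symbols as the largest `m` with `Λ₁(f) ⊆ mΛ₀(f)` (answering, for `d = 1`, Agashe–Ribet–Stein 2006 Remark 3.6).
[cite: CalegariDimitrovTang2025, Thm. 1.0.1] [cite: AgasheRibetStein2006, Remark 3.6] [cite: Stevens1989, §2] -/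
theorem natAbs_maninConstant_eq_content_of_CDT (hCDT : CalegariDimitrovTang2025_unboundedDenominators)
    {N : ℕ} [NeZero N] {W : WeierstrassCurve ℚ} [W.IsElliptic] [W.IsGloballyMinimal]
    (D : ModularParametrizationData W N)
    (hopt : ∀ z ∈ D.L.lattice, ∃ w ∈ periodLattice D.f, z = D.c * w)
    (m : ℤ) (hm : 0 < m) (hdiv : ∀ z ∈ periodLatticeGamma1 D.f, ∃ w ∈ periodLattice D.f, z = (m : ℂ) * w)
    (hmax : ∀ m' : ℤ, m' ≠ 0 → (∀ z ∈ periodLatticeGamma1 D.f, ∃ w ∈ periodLattice D.f, z = (m' : ℂ) * w) → m' ∣ m) :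
    (D.maninConstant.natAbs : ℤ) = m := by
  have hΛ₁ : ∀ z ∈ periodLatticeGamma1 D.f, z ∈ D.L.lattice := CDivisionInt.periodLatticeGamma1_le_neron_of_CDTInt hCDT D
  have h1 : m ∣ D.maninConstant := contentDividesManinConstant_holds D m hm.ne' hdiv
  have hc0 : D.c ≠ 0 := by
    have h0 := ModularParametrizationData.maninConstant_ne_zero_holds D
    simpa [ModularParametrizationData.maninConstant_ne_zero, ModularParametrizationData.maninConstant] using h0
  have h2 : D.maninConstant ∣ m := by
    have h2' : D.c ∣ m := hmax D.c hc0 (fun z hz ↦ hopt z (hΛ₁ z hz))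
    simpa [ModularParametrizationData.maninConstant] using h2'
  rw [Int.natAbs_eq_of_dvd_dvd h2 h1]
  exact Int.natAbs_of_nonneg hm.le

/-- **The C2 reading, modulo CDT: `2 ∣ c₀ ↔ Λ₁(f) ⊆ 2·Λ₀(f)`** for a lattice-optimal `X₀(N)`-datum of a globally minimal curve
(→ lattice bookkeeping from `Λ₁ ⊆ Λ_W = c₀Λ₀`; ← is `contentDividesManinConstant_holds` with `m = 2`).  So C2 (`ManinOddAtFour`) at a level
`4 ∣ N` says, modulo CDT: the `Γ₁(N)`-periods of the newform are never all divisible by `2` in its `Γ₀(N)`-period lattice (cf. the tree's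
`CDivisionNeron.indexFour_of_gamma1Periods_le_of_four_dvd_of_two_dvd`, the → half with the sharper conclusion `Λ₁ = 2Λ₀`).
[cite: CalegariDimitrovTang2025, Thm. 1.0.1] [cite: LingOesterle1991, Thm. 6] -/
theorem two_dvd_maninConstant_iff_gamma1_le_two_smul_of_CDT (hCDT : CalegariDimitrovTang2025_unboundedDenominators)
    {N : ℕ} [NeZero N] {W : WeierstrassCurve ℚ} [W.IsElliptic] [W.IsGloballyMinimal]
    (D : ModularParametrizationData W N)
    (hopt : ∀ z ∈ D.L.lattice, ∃ w ∈ periodLattice D.f, z = D.c * w) :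
    (2 : ℤ) ∣ D.maninConstant ↔ ∀ z ∈ periodLatticeGamma1 D.f, ∃ w ∈ periodLattice D.f, z = (2 : ℂ) * w := by
  have hΛ₁ : ∀ z ∈ periodLatticeGamma1 D.f, z ∈ D.L.lattice := CDivisionInt.periodLatticeGamma1_le_neron_of_CDTInt hCDT D
  constructor
  · rintro ⟨k, hk⟩ z hz
    obtain ⟨w, hw, e⟩ := hopt z (hΛ₁ z hz)
    refine ⟨(k : ℂ) * w, ?_, ?_⟩
    · have := (periodLattice D.f).zsmul_mem hw k
      simpa [zsmul_eq_mul] using this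
    · have hc : (D.c : ℂ) = 2 * k := by
        have : D.c = 2 * k := by simpa [ModularParametrizationData.maninConstant] using hk
        exact_mod_cast this
      rw [e, hc]; ring
  · intro hdiv
    exact contentDividesManinConstant_holds D 2 two_ne_zero hdiv

end Summit.BirchSwinnertonDyer.BirchSwinnertonDyer.Theorems.ManinLocalTwoThree.ManinConstantContent
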